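import Literature.NumberTheory.EllipticCurves.KubertTateM37152SqrtNegTwoDescent
import Literature.NumberTheory.EllipticCurves.KubertTate1718SqrtNegTwoTwist
import HarnessLib

/-!
# The quadratic twist `E_{−37/152}^{(−8)}/ℚ`: RANK `1` and `t₅ = 0`, by the `5`-descent over `ℚ(√−2)` with an inert place

PROOF-ONLY file (theorems only, no definition, no named fact, no `sorry`), topic `NumberTheory/EllipticCurves`; second instance of the
`ℚ(√−2)` twist door (class-wide splitting `KubertTateSqrtNegTwoTwist.mordellWeilRank_base_eq_add_sqrtNegTwo`,
`shaCorank_twist_eq_zero_of_base_sqrtNegTwo`; descent `KubertTateM37152SqrtNegTwoDescent`: `rank E_{−37/152}(K) = 3`, `t₅(E ⊗ K) = 0`):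

* `twist_eq` — `E_{−37/152}^{(−8)} = [0, −116434, 0, 5170120704, −93537933197312]` (`b₂ = 58217`, `b₄ = 161566272`, `b₆ = 730765103104`);
* **`mordellWeilRank_twist_eq_one`** — `rank E_{−37/152}^{(−8)}(ℚ) = 3 − 2 = 1`; **`shaCorank_five_twist_eq_zero`** — `t₅(E_{−37/152}^{(−8)}/ℚ) = 0`;
  `twist_M37_152` — both, with `rank E_{−37/152}(ℚ) = 2`, `t₅(E_{−37/152}) = 0` (tree `KubertTateM37152ShaFive`).

So `corank_{ℤ₅} Sel_{5^∞}(E_{−37/152}^{(−8)}/ℚ) = 1` (`selmerCorank_five_twist_eq_one`, Greenberg's identity): a RANK-ONE curve WITHOUT rational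
`5`-torsion whose door at `5` — good (`5 ∤ 8·Δ(E)`), Eisenstein (rational `5`-isogeny), NON-anomalous (`5` inert in `ℚ(√−2)`: `a₅ = −a₅(E) = −1`)
— has exactly the shape consumed by the printed Eisenstein `5`-converse (Castella–Grossi–Lee–Skinner 2022, Thm. E, `r = 1`).  Unlike the
companion row `E_{17/18}^{(−8)}` (`v₂(Δ_min) = 23`), here `v₂(Δ) = 33 ≥ 24`, outside the tree's Kraus test at `2`
(`isMinimalAt_two_of_kraus`), so no globally minimal model is certified in this file and the CGLS reading is left to a sequel.
Instrument for stmt-BirchSwinnertonDyer-22356 («T»); BSD and T are NOT proved by this.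

## References

* [SilvermanAEC2009] J. H. Silverman, *AEC*, 2nd ed., Thm. X.4.2, Exercise 10.16, X.§2.
* [Dokchitser2013ParityNotes] T. Dokchitser, *Notes on the parity conjecture* (2013), §4.
* [CastellaGrossiLeeSkinner2022] F. Castella, G. Grossi, J. Lee, C. Skinner, Invent. Math. 227 (2022), Thm. E.
-/

noncomputable section

open scoped Classical
open WeierstrassCurve Literature.NumberTheory.EllipticCurves Literature.NumberTheory.EllipticCurves.KubertTateVelu
  Literature.NumberTheory.EllipticCurves.KubertTateGaussianTwist Literature.NumberTheory.QuadraticFields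
  Literature.NumberTheory.EllipticCurves.KubertTateSqrtNegTwoTwist

namespace Literature.NumberTheory.EllipticCurves

namespace KubertTateM37152SqrtNegTwoTwist

/-- **`E_{−37/152}^{(−8)} = [0, −116434, 0, 5170120704, −93537933197312]`**. [cite: SilvermanAEC2009, X.§2] -/
theorem twist_eq : (kubertTateFive (((-37 : ℤ) : ℚ)) (((152 : ℤ) : ℚ))).quadraticTwist (-8) =
    (⟨0, -116434, 0, 5170120704, -93537933197312⟩ : WeierstrassCurve ℚ) := by
  rw [KubertTateM37152Descent.curve_eq]
  ext <;> simp [quadraticTwist, WeierstrassCurve.b₂, WeierstrassCurve.b₄, WeierstrassCurve.b₆] <;> norm_num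

/-- The twist by `−8` is elliptic. [cite: SilvermanAEC2009, X.§2] -/
theorem isElliptic_twist :
    haveI := KubertTateM37152Descent.isElliptic
    ((kubertTateFive (((-37 : ℤ) : ℚ)) (((152 : ℤ) : ℚ))).quadraticTwist (-8)).IsElliptic := by
  haveI := KubertTateM37152Descent.isElliptic
  exact isElliptic_quadraticTwist _ (by norm_num)

/-- **`rank E_{−37/152}^{(−8)}(ℚ) = 1`, unconditionally**: `rank E(K) = rank E(ℚ) + rank E^{(−8)}(ℚ)` at `K = ℚ(√−2)` with `3 = 2 + rank E^{(−8)}(ℚ)`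
(`KubertTateM37152SqrtNegTwoDescent.mordellWeilRank_eq_three`, `KubertTateM37152Descent.mordellWeilRank_eq`). [cite: SilvermanAEC2009, Exercise 10.16] -/
theorem mordellWeilRank_twist_eq_one :
    haveI := KubertTateM37152Descent.isElliptic
    haveI := isElliptic_twist
    ((kubertTateFive (((-37 : ℤ) : ℚ)) (((152 : ℤ) : ℚ))).quadraticTwist (-8)).mordellWeilRank = 1 := by
  haveI := KubertTateM37152Descent.isElliptic
  haveI := isElliptic_twist
  obtain ⟨K, _, _, θ, hK⟩ := exists_sqrtNegTwo_field
  have hR := mordellWeilRank_base_eq_add_sqrtNegTwo (K := K) (-37) 152 hK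
  have h3 := KubertTateM37152SqrtNegTwoDescent.mordellWeilRank_eq_three hK
  have h2 := KubertTateM37152Descent.mordellWeilRank_eq
  simp only [Int.cast_ofNat, Int.cast_neg] at hR h3 h2 ⊢
  omega

/-- **`t₅(E_{−37/152}^{(−8)}/ℚ) = 0`, unconditionally** — the door at `5` on a RANK-`1` twist WITHOUT a rational `5`-torsion point, at a
NON-anomalous good Eisenstein prime, by descent alone. [cite: Dokchitser2013ParityNotes, §4] [cite: SilvermanAEC2009, Thm. X.4.2] -/
theorem shaCorank_five_twist_eq_zero :
    haveI := KubertTateM37152Descent.isElliptic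
    haveI := isElliptic_twist
    ((kubertTateFive (((-37 : ℤ) : ℚ)) (((152 : ℤ) : ℚ))).quadraticTwist (-8)).shaCorank 5 = 0 := by
  haveI := KubertTateM37152Descent.isElliptic
  haveI := isElliptic_twist
  obtain ⟨K, _, _, θ, hK⟩ := exists_sqrtNegTwo_field
  have h := shaCorank_twist_eq_zero_of_base_sqrtNegTwo (K := K) (-37) 152 hK
    (by simpa using KubertTateM37152SqrtNegTwoDescent.shaCorank_five_eq_zero hK)
  simpa using h.1

/-- **`corank_{ℤ₅} Sel_{5^∞}(E_{−37/152}^{(−8)}/ℚ) = 1`** (Greenberg's identity `corank Sel = rank + t` with `rank = 1`, `t₅ = 0`): the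
Selmer hypothesis of CGLS Theorem E at `r = 1`. [cite: CastellaGrossiLeeSkinner2022, Thm. E (hypothesis corank = 1)] -/
theorem selmerCorank_five_twist_eq_one :
    haveI := KubertTateM37152Descent.isElliptic
    haveI := isElliptic_twist
    haveI : Fact (Nat.Prime 5) := ⟨Nat.prime_five⟩
    ((kubertTateFive (((-37 : ℤ) : ℚ)) (((152 : ℤ) : ℚ))).quadraticTwist (-8)).selmerCorank 5 = 1 := by
  haveI := KubertTateM37152Descent.isElliptic
  haveI := isElliptic_twist
  haveI : Fact (Nat.Prime 5) := ⟨Nat.prime_five⟩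
  rw [((kubertTateFive (((-37 : ℤ) : ℚ)) (((152 : ℤ) : ℚ))).quadraticTwist (-8)).selmerCorank_eq_mordellWeilRank_add_holds 5,
    mordellWeilRank_twist_eq_one, shaCorank_five_twist_eq_zero]

/-- **Both sides of the field**: `rank E_{−37/152}^{(−8)}(ℚ) = 1`, `t₅(E^{(−8)}) = 0`, `rank E_{−37/152}(ℚ) = 2`, `t₅(E) = 0` —
`rank E(ℚ(√−2)) = 2 + 1`, `t₅(E ⊗ ℚ(√−2)) = 0 + 0`. [cite: SilvermanAEC2009, Thm. X.4.2 and Exercise 10.16] -/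
theorem twist_M37_152 :
    haveI := KubertTateM37152Descent.isElliptic
    haveI := isElliptic_twist
    ((kubertTateFive (((-37 : ℤ) : ℚ)) (((152 : ℤ) : ℚ))).quadraticTwist (-8)).mordellWeilRank = 1 ∧
      ((kubertTateFive (((-37 : ℤ) : ℚ)) (((152 : ℤ) : ℚ))).quadraticTwist (-8)).shaCorank 5 = 0 ∧
      (kubertTateFive (((-37 : ℤ) : ℚ)) (((152 : ℤ) : ℚ))).mordellWeilRank = 2 ∧
      (kubertTateFive (((-37 : ℤ) : ℚ)) (((152 : ℤ) : ℚ))).shaCorank 5 = 0 :=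
  ⟨mordellWeilRank_twist_eq_one, shaCorank_five_twist_eq_zero, KubertTateM37152Descent.mordellWeilRank_eq,
    KubertTateM37152Descent.shaCorank_five_eq_zero⟩

end KubertTateM37152SqrtNegTwoTwist

end Literature.NumberTheory.EllipticCurves

end
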